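import Mathlib.MeasureTheory.Integral.IntervalIntegral.FundThmCalculus
import Summits.CriticalPhenomena.PercolationContinuityZ3.Theorems.PercMinContactSwallowInequalityProbe
import HarnessLib

/-!
# Route PercMinContact — support `SwallowInequality` (stmt-CriticalPhenomena-11500), part 2:
# locality, Russo's formula, the merger bound and mass transport

Helper file (supports stmt-CriticalPhenomena-11500; pure proofs over part 1,
`PercMinContactSwallowInequalityProbe.lean`). Contents (namespace `…Theorems.SwallowIneq`):

* `exists_finset_of_le_encard` (growing a finite open tree inside `Λ_{j-1}`) and the LOCALITY of
  the truncation events `A_k` (`determinedBy_sizeEvent`, `determinedBy_sizeEvent_edgesN`), their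
  measurability, and the MERGER LEMMA `merger_of_isPivotal`: a closed lattice edge pivotal for
  `A_k` has exactly one endpoint in `C(0)` and `|C(0)| < k ≤ |C(0)| + |C(other endpoint)|`;
* RUSSO for the probe (`hasDerivAt_fN`, from `russo_formula_sum_holds`), continuity of `D_N`
  (cylinder polynomials) and the FTC `f_N(b) - f_N(a) = ∫_{(a,b)} D_N` for `[a, b] ⊆ (0, 1)`;
* the pointwise merger bound `Σ_k 1{e closed pivotal for A_k} ≤ h_N(a,b) + h_N(b,a)`
  (`sum_indicator_piv_le`), RESAMPLING of the pivotal edge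
  `P(e pivotal, closed) = (1-u) P(e pivotal)` (`real_pivEvent_inter_notMem`), translation covariance
  of `h_N` and the MASS-TRANSPORT identity `Σ_v E[h_N(v, v + y)] = E[|C(0)| H_N(y)]`
  (`tsum_lintegral_hfun`), and the integrated kernel bound `E[|C(0)| Σ_y H_N(y)] ≤ N m(u)`.

Sources: Russo (1981) / Grimmett (1999) Thm. 2.25; Aizenman–Barsky (1987) and Grimmett (1999)
Lemma (5.51); Hutchcroft (2020) §2–3 (mass transport, resampling one edge).
-/

noncomputable section

namespace Summit.CriticalPhenomena.PercolationContinuityZ3.Theorems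

open MeasureTheory Filter Literature.Probability.Percolation Literature.Probability.LatticeModels
open scoped Topology ENNReal

namespace SwallowIneq

/-! ### Locality of the truncation events and the merger lemma -/

section Events

variable {d : ℕ}

/-- **Growing a finite open tree.** In a lattice configuration `ω ⊆ E(ℤ^d)`, if `|C(0)| ≥ j ≥ 1`
then there is a set `T` of `j` vertices with `0 ∈ T ⊆ Λ_{j-1}` every vertex of which is joined
to `0` by an open path all of whose edges have both endpoints in `T`. -/
theorem exists_finset_of_le_encard {ω : BondConfig (Site d)} (hω : ω ⊆ (zdGraph d).edgeSet)
    {j : ℕ} (hj : 1 ≤ j) (hle : (j : ℕ∞) ≤ (openCluster ω 0).encard) :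
    ∃ T : Finset (Site d), 0 ∈ T ∧ T.card = j ∧ T ⊆ box d (j - 1) ∧
      ∀ x ∈ T, (openGraph (ω ∩ (↑T : Set (Site d)).sym2)).Reachable 0 x := by
  induction j, hj using Nat.le_induction with
  | base =>
    refine ⟨{0}, Finset.mem_singleton_self 0, Finset.card_singleton 0, ?_, ?_⟩
    · intro x hx
      rw [Finset.mem_singleton] at hx
      rw [hx]; exact zero_mem_box d _
    · intro x hx
      rw [Finset.mem_singleton] at hx
      rw [hx]
  | succ j hj ih =>
    obtain ⟨T, h0, hcard, hbox, hreach⟩ :=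
      ih (le_trans (by exact_mod_cast Nat.le_succ j) hle)
    -- a vertex of `C(0)` outside `T`
    have hex : ∃ z ∈ openCluster ω 0, z ∉ T := by
      by_contra hcon
      push Not at hcon
      have hsub : openCluster ω 0 ⊆ ↑T := fun z hz => Finset.mem_coe.2 (hcon z hz)
      have h1 := Set.encard_le_encard hsub
      rw [Set.encard_coe_eq_coe_finsetCard, hcard] at h1
      have h2 := hle.trans h1
      norm_cast at h2
      omega
    obtain ⟨z, hz, hzT⟩ := hex
    obtain ⟨p⟩ := (hz : (openGraph ω).Reachable 0 z)
    obtain ⟨e, -, hxT, hyT⟩ := p.exists_boundary_dart (↑T) (Finset.mem_coe.2 h0)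
      (fun h => hzT (Finset.mem_coe.1 h))
    have hxT' : e.fst ∈ T := Finset.mem_coe.1 hxT
    have hyT' : e.snd ∉ T := fun h => hyT (Finset.mem_coe.2 h)
    have hadj : (openGraph ω).Adj e.fst e.snd := e.adj
    rw [openGraph_adj] at hadj
    refine ⟨insert e.snd T, Finset.mem_insert_of_mem h0,
      by rw [Finset.card_insert_of_notMem hyT', hcard], ?_, ?_⟩
    · -- the new set lies in `Λ_j`
      intro w hw
      rw [Nat.add_sub_cancel]
      rcases Finset.mem_insert.1 hw with rfl | hw
      · have hx : e.fst ∈ box d (j - 1) := hbox hxT'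
        have := DCT16.mem_box_succ_of_adj hx (hω hadj.1)
        exact box_mono d (by omega) this
      · exact box_mono d (by omega) (hbox hw)
    · intro w hw
      have hmono : ω ∩ (↑T : Set (Site d)).sym2 ⊆ ω ∩ (↑(insert e.snd T) : Set (Site d)).sym2 := by
        refine Set.inter_subset_inter_right _ ?_
        intro f hf
        induction f using Sym2.ind with
        | h a b =>
          rw [Set.mk_mem_sym2_iff] at hf ⊢
          rw [Finset.coe_insert]
          exact ⟨Set.mem_insert_of_mem _ hf.1, Set.mem_insert_of_mem _ hf.2⟩
      rcases Finset.mem_insert.1 hw with rfl | hw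
      · -- reach `e.snd` through `e.fst`
        have h1 : (openGraph (ω ∩ (↑(insert e.snd T) : Set (Site d)).sym2)).Reachable 0 e.fst :=
          (hreach _ hxT').mono (openGraph_mono hmono)
        refine h1.trans (SimpleGraph.Adj.reachable ?_)
        rw [openGraph_adj]
        refine ⟨⟨hadj.1, ?_⟩, hadj.2⟩
        rw [Set.mk_mem_sym2_iff, Finset.coe_insert]
        exact ⟨Set.mem_insert_of_mem _ (Finset.mem_coe.2 hxT'), Set.mem_insert _ _⟩
      · exact (hreach w hw).mono (openGraph_mono hmono)

/-- **Locality of `A_k`.** The event `A_k` is determined by any set of pairs containing the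
lattice edges with both endpoints in `Λ_{k-1}`. -/
theorem determinedBy_sizeEvent (d k : ℕ) {K : Set (Sym2 (Site d))}
    (hK : ∀ e ∈ (zdGraph d).edgeSet, e ∈ ((box d (k - 1) : Finset (Site d)) : Set (Site d)).sym2 → e ∈ K) :
    DeterminedBy (sizeEvent d k) K := by
  -- one direction suffices
  suffices key : ∀ ω ω' : BondConfig (Site d), ω ∩ K = ω' ∩ K → ω ∈ sizeEvent d k → ω' ∈ sizeEvent d k by
    rw [determinedBy_iff]
    exact fun ω ω' h => ⟨key ω ω' h, key ω' ω h.symm⟩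
  intro ω ω' h hω
  rcases Nat.eq_zero_or_pos k with rfl | hk
  · rw [sizeEvent_zero]; exact Set.mem_univ _
  rw [mem_sizeEvent] at hω ⊢
  obtain ⟨T, -, hcard, hbox, hreach⟩ := exists_finset_of_le_encard (latt_subset ω) hk hω
  have hsub : latt ω ∩ (↑T : Set (Site d)).sym2 ⊆ latt ω' := by
    rintro f ⟨⟨hfω, hfE⟩, hfT⟩
    refine ⟨?_, hfE⟩
    have hfK : f ∈ K := by
      refine hK f hfE ?_
      induction f using Sym2.ind with
      | h a b =>
        rw [Set.mk_mem_sym2_iff] at hfT ⊢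
        exact ⟨hbox hfT.1, hbox hfT.2⟩
    have : f ∈ ω' ∩ K := by rw [← h]; exact ⟨hfω, hfK⟩
    exact this.1
  have hT : (↑T : Set (Site d)) ⊆ openCluster (latt ω') 0 :=
    fun x hx => (hreach x (Finset.mem_coe.1 hx)).mono (openGraph_mono hsub)
  have := Set.encard_le_encard hT
  rw [Set.encard_coe_eq_coe_finsetCard, hcard] at this
  exact this

/-- `A_k` is measurable. -/
theorem measurableSet_sizeEvent (d k : ℕ) : MeasurableSet (sizeEvent d k) := by
  classical
  have h := determinedBy_sizeEvent d k (K := ↑(((box d (k - 1)).sym2).filter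
    (fun e => e ∈ (zdGraph d).edgeSet))) (by
      intro e he hbox
      rw [Finset.coe_filter, Set.mem_setOf_eq]
      refine ⟨?_, he⟩
      induction e using Sym2.ind with
      | h a b =>
        rw [Set.mk_mem_sym2_iff] at hbox
        exact Finset.mk_mem_sym2_iff.2 ⟨hbox.1, hbox.2⟩)
  exact h.measurableSet_of_finset

/-- **Pivotality for `A_k` forces a merger.** For a lattice configuration `ω`, a closed lattice
edge `{a, b}` pivotal for `A_k` has exactly one endpoint in `C(0) = C_ω(0)`, and
`|C(0)| < k ≤ |C(0)| + |C(other endpoint)|`. -/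
theorem merger_of_isPivotal {ω : BondConfig (Site d)} (hω : ω ⊆ (zdGraph d).edgeSet) {k : ℕ}
    {a b : Site d} (hab : s(a, b) ∈ (zdGraph d).edgeSet) (hcl : s(a, b) ∉ ω)
    (hpiv : IsPivotal (sizeEvent d k) s(a, b) ω) :
    (a ∈ openCluster ω 0 ∧ b ∉ openCluster ω 0 ∧ (openCluster ω 0).encard < k ∧
        (k : ℕ∞) ≤ (openCluster ω 0).encard + (openCluster ω b).encard) ∨
      (b ∈ openCluster ω 0 ∧ a ∉ openCluster ω 0 ∧ (openCluster ω 0).encard < k ∧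
        (k : ℕ∞) ≤ (openCluster ω 0).encard + (openCluster ω a).encard) := by
  rw [Russo.isPivotal_iff_of_notMem (isUpperSet_sizeEvent d k) hcl, mem_sizeEvent, mem_sizeEvent,
    latt_eq_of_subset hω, latt_eq_of_subset (Set.insert_subset hab hω), not_le] at hpiv
  obtain ⟨hins, hlt⟩ := hpiv
  by_cases ha : a ∈ openCluster ω 0 <;> by_cases hb : b ∈ openCluster ω 0
  · -- both endpoints in `C(0)`: nothing changes
    exfalso
    have hsub := openCluster_insert_subset_union (b := b) ha
    rw [TwoGhost.openCluster_eq_of_mem hb, Set.union_self] at hsub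
    exact absurd (hins.trans (Set.encard_le_encard hsub)) (not_le.2 hlt)
  · left
    refine ⟨ha, hb, hlt, hins.trans ?_⟩
    exact (Set.encard_le_encard (openCluster_insert_subset_union ha)).trans (Set.encard_union_le _ _)
  · right
    refine ⟨hb, ha, hlt, hins.trans ?_⟩
    rw [Sym2.eq_swap]
    exact (Set.encard_le_encard (openCluster_insert_subset_union hb)).trans (Set.encard_union_le _ _)
  · exfalso
    rw [openCluster_insert_eq_of_notMem ha hb] at hins
    exact absurd hins (not_le.2 hlt)

end Events

/-! ### Russo's formula for the probe and the fundamental theorem of calculus -/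

section Probe

variable {d : ℕ}

/-- `A_k` is determined by `edgesN d N` for `k ≤ N`. -/
theorem determinedBy_sizeEvent_edgesN {k N : ℕ} (hk : k ≤ N) :
    DeterminedBy (sizeEvent d k) ↑(edgesN d N) := by
  refine determinedBy_sizeEvent d k fun e he hbox => Finset.mem_coe.2 (mem_edgesN_of_mem_sym2 he ?_)
  exact sym2_subset_sym2 (Finset.coe_subset.2 (box_mono d (by omega))) hbox

/-- `pivEvent d k e` is determined by `edgesN d N ∖ {e}` (`k ≤ N`). -/
theorem determinedBy_pivEvent {k N : ℕ} (hk : k ≤ N) (e : Sym2 (Site d)) :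
    DeterminedBy (pivEvent d k e) ↑((edgesN d N).erase e) := by
  classical
  exact Russo.determinedBy_isPivotal (determinedBy_sizeEvent_edgesN hk) e

/-- `pivEvent` is measurable. -/
theorem measurableSet_pivEvent (d k : ℕ) (e : Sym2 (Site d)) : MeasurableSet (pivEvent d k e) :=
  (determinedBy_pivEvent (le_refl k) e).measurableSet_of_finset

/-- **Russo's formula for the probe**: `f_N' = D_N` on `(0, 1)`. -/
theorem hasDerivAt_fN {N : ℕ} {u : ℝ} (hu : u ∈ Set.Ioo (0 : ℝ) 1) :
    HasDerivAt (fN d N) (DN d N u) u := by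
  classical
  unfold fN DN
  refine HasDerivAt.const_mul _ (HasDerivAt.fun_sum fun k hk => ?_)
  have hkN : k ≤ N := (Finset.mem_Icc.1 hk).2
  have h := russo_formula_sum_holds (zdGraph d) (isUpperSet_sizeEvent d k) (edgesN d N)
    (determinedBy_sizeEvent_edgesN hkN) u hu
  have heq : ∑ e ∈ edgesN d N, (bondPercolation (zdGraph d) (Set.projIcc 0 1 zero_le_one u)).real
      {ω | e ∈ (zdGraph d).edgeSet ∧ IsPivotal (sizeEvent d k) e ω} =
      ∑ e ∈ edgesN d N, (P d u).real (pivEvent d k e) := by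
    refine Finset.sum_congr rfl fun e he => ?_
    have : {ω | e ∈ (zdGraph d).edgeSet ∧ IsPivotal (sizeEvent d k) e ω} = pivEvent d k e := by
      ext ω; simp [pivEvent, edgesN_subset_edgeSet he]
    rw [this]; rfl
  rw [heq] at h
  exact h

/-- The probability of an event determined by finitely many pairs is continuous in the level
(a polynomial composed with the clamp). -/
theorem continuous_real_of_determinedBy {B : Set (BondConfig (Site d))} {F : Finset (Sym2 (Site d))}
    (hB : DeterminedBy B ↑F) : Continuous fun u : ℝ => (P d u).real B := by
  classical
  have h : (fun u : ℝ => (P d u).real B) =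
      fun u => Russo.cylPoly (zdGraph d).edgeSet F B (Set.projIcc 0 1 zero_le_one u) := by
    funext u
    exact Russo.measureReal_eq_cylPoly hB _ _
  rw [h]
  have hc : Continuous (Russo.cylPoly (zdGraph d).edgeSet F B) :=
    continuous_iff_continuousAt.2 fun q => (Russo.hasDerivAt_cylPoly _ _ _ q).continuousAt
  exact hc.comp (continuous_subtype_val.comp continuous_projIcc)

/-- `D_N` is continuous. -/
theorem continuous_DN (d N : ℕ) : Continuous (DN d N) := by
  unfold DN
  refine continuous_const.mul (continuous_finsetSum _ fun k hk => continuous_finsetSum _ fun e _ => ?_)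
  exact continuous_real_of_determinedBy (determinedBy_pivEvent (Finset.mem_Icc.1 hk).2 e)

/-- **FTC**: `f_N(b) - f_N(a) = ∫_a^b D_N` for `0 < a ≤ b < 1`. -/
theorem fN_sub_eq_integral {N : ℕ} {a b : ℝ} (ha : 0 < a) (hab : a ≤ b) (hb : b < 1) :
    fN d N b - fN d N a = ∫ u in a..b, DN d N u := by
  refine (intervalIntegral.integral_eq_sub_of_hasDerivAt (fun u hu => hasDerivAt_fN ?_)
    ((continuous_DN d N).intervalIntegrable _ _)).symm
  rw [Set.uIcc_of_le hab] at hu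
  exact ⟨ha.trans_le hu.1, hu.2.trans_lt hb⟩

/-- FTC in `ℝ≥0∞`: `f_N(b) - f_N(a) = ∫⁻_{(a,b)} D_N`. -/
theorem ofReal_fN_sub (N : ℕ) {a b : ℝ} (ha : 0 < a) (hab : a ≤ b) (hb : b < 1) :
    ENNReal.ofReal (fN d N b - fN d N a) = ∫⁻ u in Set.Ioo a b, ENNReal.ofReal (DN d N u) := by
  rw [fN_sub_eq_integral ha hab hb, intervalIntegral.integral_of_le hab,
    ofReal_integral_eq_lintegral_ofReal (continuous_DN d N).integrableOn_Ioc
      (Eventually.of_forall fun u => DN_nonneg d N u)]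
  exact setLIntegral_congr Ioo_ae_eq_Ioc.symm

end Probe

/-! ### The merger bound, resampling and mass transport -/

section Transport

variable {d : ℕ}

/-- **The merger bound (pointwise).** For a lattice configuration `ω` and a lattice edge
`e = {a, b}`, the number of levels `k ≤ N` at which `e` is a closed pivotal edge for `A_k` is at
most `h_N(a, b, ω) + h_N(b, a, ω)`: opening a closed pivotal edge merges `C(0)` with the cluster
at its other endpoint. -/
theorem sum_indicator_piv_le {ω : BondConfig (Site d)} (hω : ω ⊆ (zdGraph d).edgeSet) (N : ℕ)
    {a b : Site d} (hab : s(a, b) ∈ (zdGraph d).edgeSet) :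
    ∑ k ∈ Finset.Icc 1 N, (pivEvent d k s(a, b) ∩ {ω | s(a, b) ∉ ω}).indicator
        (1 : BondConfig (Site d) → ℝ≥0∞) ω ≤ hfun N a b ω + hfun N b a ω := by
  classical
  by_cases hcl : s(a, b) ∈ ω
  · have : ∀ k ∈ Finset.Icc 1 N, (pivEvent d k s(a, b) ∩ {ω | s(a, b) ∉ ω}).indicator
        (1 : BondConfig (Site d) → ℝ≥0∞) ω = 0 :=
      fun k _ => Set.indicator_of_notMem (fun h => h.2 hcl) _
    rw [Finset.sum_eq_zero this]; exact bot_le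
  · rw [hfun_eq_sum, hfun_eq_sum, ← Finset.sum_add_distrib]
    refine Finset.sum_le_sum fun k _ => ?_
    by_cases hp : IsPivotal (sizeEvent d k) s(a, b) ω
    · rw [Set.indicator_of_mem (show ω ∈ pivEvent d k s(a, b) ∩ {ω | s(a, b) ∉ ω} from ⟨hp, hcl⟩),
        Pi.one_apply]
      rcases merger_of_isPivotal hω hab hcl hp with ⟨h1, h2, h3, h4⟩ | ⟨h1, h2, h3, h4⟩
      · rw [if_pos ⟨h1, h2, h3, h4⟩]; exact le_self_add
      · rw [if_pos (show b ∈ openCluster ω 0 ∧ a ∉ openCluster ω 0 ∧ (openCluster ω 0).encard < k ∧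
            (k : ℕ∞) ≤ (openCluster ω 0).encard + (openCluster ω a).encard from ⟨h1, h2, h3, h4⟩)]
        exact le_add_self
    · rw [Set.indicator_of_notMem (fun h => hp h.1)]; exact bot_le

/-- **Resampling the pivotal edge**: `P(e pivotal, e closed) = (1 - u) P(e pivotal)`, since
pivotality of `e` does not depend on the state of `e`. -/
theorem real_pivEvent_inter_notMem {k N : ℕ} (hk : k ≤ N) (u : ℝ) {e : Sym2 (Site d)}
    (he : e ∈ edgesN d N) :
    (P d u).real (pivEvent d k e ∩ {ω | e ∉ ω}) =
      (P d u).real (pivEvent d k e) * (1 - (Set.projIcc (0 : ℝ) 1 zero_le_one u : ℝ)) := by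
  classical
  have hA := determinedBy_pivEvent (d := d) hk e
  have hB : DeterminedBy {ω : BondConfig (Site d) | e ∉ ω} ↑({e} : Finset (Sym2 (Site d))) := by
    rw [Finset.coe_singleton]; exact (determinedBy_mem e).compl
  have hdisj : Disjoint ((edgesN d N).erase e) {e} := by
    rw [Finset.disjoint_singleton_right]; exact Finset.notMem_erase e _
  unfold P
  rw [DCT16.real_inter_of_determinedBy_disjoint (zdGraph d) _ hA hB hdisj,
    DCT16.real_notMem (zdGraph d) _ (edgesN_subset_edgeSet he)]

open Classical in
/-- **Translation covariance of `h_N`**: `h_N(v, v + y, ω + v) = 1{-v ∈ C_ω(0)} H_N(y, ω)`. -/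
theorem hfun_shiftConfig (N : ℕ) (v y : Site d) (ω : BondConfig (Site d)) :
    hfun N v (v + y) (TwoGhost.shiftConfig v ω) =
      (if -v ∈ openCluster ω 0 then 1 else 0) * Hfun N y ω := by
  classical
  have hv : v ∈ openCluster (TwoGhost.shiftConfig v ω) 0 ↔ -v ∈ openCluster ω 0 := by
    have := TwoGhost.add_mem_openCluster_shiftConfig_iff v ω (-v) 0
    rw [zero_add, neg_add_cancel] at this
    exact this.trans TwoGhost.mem_openCluster_comm
  have hy : v + y ∈ openCluster (TwoGhost.shiftConfig v ω) 0 ↔ y ∈ openCluster ω (-v) := by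
    have := TwoGhost.add_mem_openCluster_shiftConfig_iff v ω (-v) y
    rw [add_comm y v, neg_add_cancel] at this
    exact this
  have hs0 : (openCluster (TwoGhost.shiftConfig v ω) 0).encard = (openCluster ω (-v)).encard := by
    have := encard_openCluster_shiftConfig v ω (-v)
    rw [neg_add_cancel] at this
    exact this
  have hsy : (openCluster (TwoGhost.shiftConfig v ω) (v + y)).encard = (openCluster ω y).encard := by
    have := encard_openCluster_shiftConfig v ω y
    rw [add_comm y v] at this
    exact this
  unfold hfun Hfun
  by_cases hm : -v ∈ openCluster ω 0
  · have hC : openCluster ω (-v) = openCluster ω 0 := TwoGhost.openCluster_eq_of_mem hm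
    rw [if_pos hm, one_mul, hs0, hsy, hC]
    by_cases hy' : y ∈ openCluster ω 0
    · rw [if_neg (fun h => h.2 (hy.2 (hC ▸ hy'))), if_neg (fun h => h hy')]
    · rw [if_pos ⟨hv.2 hm, fun h => hy' (hC ▸ hy.1 h)⟩, if_pos hy']
  · rw [if_neg hm, zero_mul, if_neg (fun h => hm (hv.1 h.1))]

/-- **Mass transport**: `Σ_v E[h_N(e v, e v + y)] = E[|C(0)| H_N(y)]` for any bijection
`e` of the vertices of the form `v ↦ v + w` (we use a general `Equiv`). -/
theorem tsum_lintegral_hfun (N : ℕ) (u : ℝ) (y : Site d) (e : Site d ≃ Site d) :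
    ∑' v : Site d, ∫⁻ ω, hfun N (e v) (e v + y) ω ∂(P d u) =
      ∫⁻ ω, (openCluster ω 0).encard * Hfun N y ω ∂(P d u) := by
  classical
  have h1 : ∀ v : Site d, ∫⁻ ω, hfun N (e v) (e v + y) ω ∂(P d u) =
      ∫⁻ ω, (if -(e v) ∈ openCluster ω 0 then 1 else 0) * Hfun N y ω ∂(P d u) := by
    intro v
    unfold P
    rw [← TwoGhost.lintegral_shiftConfig (e v) _ (hfun N (e v) (e v + y))]
    exact lintegral_congr fun ω => hfun_shiftConfig N (e v) y ω
  simp_rw [h1]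
  have hmeas : ∀ v : Site d, Measurable fun ω : BondConfig (Site d) =>
      (if -(e v) ∈ openCluster ω 0 then (1 : ℝ≥0∞) else 0) * Hfun N y ω := by
    intro v
    refine Measurable.mul ?_ (measurable_Hfun N y)
    exact Measurable.ite (TwoGhost.measurableSet_mem_openCluster 0 (-(e v))) measurable_const measurable_const
  rw [← lintegral_tsum fun v => (hmeas v).aemeasurable]
  refine lintegral_congr fun ω => ?_
  rw [ENNReal.tsum_mul_right]
  congr 1
  rw [← tsum_ite_mem_eq_encard (openCluster ω 0)]
  exact (e.trans (Equiv.neg (Site d))).tsum_eq (fun v => if v ∈ openCluster ω 0 then (1 : ℝ≥0∞) else 0)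

/-- **The kernel bound, integrated**: `E[|C(0)| Σ_{y ∼ 0} H_N(y)] ≤ N · m(u)`. -/
theorem lintegral_encard_mul_sum_Hfun_le (N : ℕ) (u : ℝ) :
    ∫⁻ ω, (openCluster ω 0).encard * ∑ y ∈ (zdGraph d).neighborFinset (0 : Site d), Hfun N y ω ∂(P d u) ≤
      N * mfun d u := by
  classical
  unfold mfun
  rw [← lintegral_const_mul' _ _ (ENNReal.natCast_ne_top N)]
  refine lintegral_mono fun ω => ?_
  rw [Finset.mul_sum, Finset.mul_sum]
  refine Finset.sum_le_sum fun y _ => ?_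
  unfold Hfun
  by_cases hy : y ∈ openCluster ω 0
  · rw [if_neg (fun h => h hy), mul_zero]; exact bot_le
  · rw [if_pos hy, Set.indicator_of_mem (show ω ∈ (openConn (0 : Site d) y)ᶜ from hy)]
    exact mul_cnt_le N _ _

end Transport

end SwallowIneq

end Summit.CriticalPhenomena.PercolationContinuityZ3.Theorems
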